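import Summits.Ventures.CertifiedManyBodySolver.Observables.PhaseSeparationExclusionBoxGrandCanonicalThermalGap
import Summits.Ventures.CertifiedManyBodySolver.Observables.PhaseSeparationExclusionBoxThermalFreeDilute
import HarnessLib

/-!
# Ventures/CertifiedManyBodySolver — Observables/PhaseSeparationExclusionBoxGrandCanonicalThermalFreeDilute.lean: the μ-AXIS competing-order
# words at `T > 0` with `s`-DEPENDENT anchors at BOTH outer densities (free-gas dilute anchor + chorded `n₂`-anchor) — one-`μ` exclusion and the
# certified chemical-potential gap, column × threshold forms

HONEST FRAMING: a transport device; the grand-canonical twin of `Observables/PhaseSeparationExclusionBoxThermalFreeDilute.lean` (g25). Laws (this seat, g22/g23):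
`IsVarEquilibrium.not_isVarEquilibrium_of_le_of_le_hotAnchors_ttPrime` (no `(β, μ)` carries both a `≤ n₁`-filled and a `≥ n₂`-filled variational equilibrium of
`H(t,s,U) − μN`) and `mul_gap_le_mul_sub_chemPot_of_equilibria_hotAnchors_threshold_ttPrime` (`a·b·(n₂−n₁)·(μ₂ − μ₁) ≥ g` for every `β ≥ β₀`), through the
function forms `psGCT_gap_on_cell_of_fns_hotAnchorFn` (g24) and `psGCT_not_equilibrium_on_cell_of_fns_hotAnchorFn` (here). The forms below take the
pressure ceilings at BOTH outer densities as functions `Q₁(s)`, `Q₂(s)` — `Q₁` = the `t′`-chord of two KERNEL free-gas ceilings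
(`pressureTT'_le_schord_of_freeGCPressureTT'`), `Q₂` = a producer-certified `n₂`-anchor (constant or chorded) — with the cap affine in `U`, the usual column
laws, dilute floor, column margins and anchored inequalities at `β₀` (all affine in `s`). CONTROL class; conditional on the rows / `n₂`-anchors an instance names;
statements about translation-invariant variational equilibria (existence not claimed); a FLOOR on `Δμ`, not an estimate; nothing about stripes, SC or `T_c`;
no number of record. Zero kit, no definition, no claim node.

Cell `pub/hubbard-downfold` (MO-S1 filling lane; D-0096 (iii), μ axis of the D-0098 map), seat `hubbard-downfold-unc-2` (g25).
References: R. B. Israel (1979) Thm I.2.4 / I.3.4 [Israel1979]; D. Ruelle (1969) §3.3–3.4 [Ruelle1969]; R. B. Griffiths, J. Math. Phys. 5 (1964) 1215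
[Griffiths1966]; D. Poulin, M. B. Hastings, PRL 106 (2011) 080403 [PoulinHastings2011].
-/

noncomputable section

namespace Summit.Ventures.CertifiedManyBodySolver.Observables

open Literature.MathematicalPhysics.QuantumLattice Literature.MathematicalPhysics.QuantumLattice.ThermodynamicLimit
open Literature.MathematicalPhysics.QuantumLattice.InfVolFermionState Set Filter

/-! ## §1 One-`μ` exclusion at `T > 0` with anchor FUNCTIONS -/

/-- **NO `(β, μ)` CARRIES BOTH PHASES on a cell, bound functions and `s`/`U`-DEPENDENT ANCHORS `P₁(s,U)`, `P₂(s,U)`** (as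
`psGCT_not_equilibrium_on_cell_of_fns_hotAnchor` with anchor functions). [cite: Israel1979, Thm. I.2.4] [cite: PoulinHastings2011, eqs. (3)–(8)] -/
theorem psGCT_not_equilibrium_on_cell_of_fns_hotAnchorFn (t : ℝ) {s₁ s₂ U₁ U₂ n₁ n₂ a b β βh₁ βh₂ : ℝ} (hU₁ : 0 ≤ U₁)
    (hβ : 0 < β) (hn₁ : 0 < n₁) (hn : n₁ < n₂) (hn₂ : n₂ < 2) (ha : 0 ≤ a) (hb : 0 ≤ b) (hab : a + b = 1)
    (hβh₁ : 0 ≤ βh₁) (hβh₂ : 0 ≤ βh₂) (hle₁ : βh₁ ≤ β) (hle₂ : βh₂ ≤ β) {C F₁ F₂ P₁ P₂ : ℝ → ℝ → ℝ}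
    (hC : ∀ s ∈ Icc s₁ s₂, ∀ U ∈ Icc U₁ U₂, energyDensityTT' t s U (a * n₁ + b * n₂) ≤ C s U)
    (hF₁ : ∀ s ∈ Icc s₁ s₂, ∀ U ∈ Icc U₁ U₂, F₁ s U ≤ energyDensityTT' t s U n₁)
    (hF₂ : ∀ s ∈ Icc s₁ s₂, ∀ U ∈ Icc U₁ U₂, F₂ s U ≤ energyDensityTT' t s U n₂)
    (hπ₁ : ∀ s ∈ Icc s₁ s₂, ∀ U ∈ Icc U₁ U₂, pressureTT' βh₁ t s U n₁ ≤ P₁ s U)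
    (hπ₂ : ∀ s ∈ Icc s₁ s₂, ∀ U ∈ Icc U₁ U₂, pressureTT' βh₂ t s U n₂ ≤ P₂ s U)
    (hM : ∀ s ∈ Icc s₁ s₂, ∀ U ∈ Icc U₁ U₂,
      a * P₁ s U + b * P₂ s U + βh₁ * (a * F₁ s U) + βh₂ * (b * F₂ s U) < β * (a * F₁ s U + b * F₂ s U - C s U))
    {s : ℝ} (hs : s ∈ Icc s₁ s₂) {U : ℝ} (hU : U ∈ Icc U₁ U₂)
    {Γ : FermionInteraction 2} {R' μ : ℝ} {ω₁ ω₂ : InfVolFermionState 2} (hω₁ : ω₁.IsVarEquilibrium β Γ R')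
    (hΓ : ∀ σ : InfVolFermionState 2, σ.meanEnergy Γ R' = σ.meanEnergy (hubbardTTPrimeFermionInteraction t s U) 1 - μ * σ.density)
    (hρ₁ : ω₁.density ≤ n₁) (hρ₂ : n₂ ≤ ω₂.density) :
    ¬ ω₂.IsVarEquilibrium β Γ R' :=
  hω₁.not_isVarEquilibrium_of_le_of_le_hotAnchors_ttPrime t s (hU₁.trans hU.1) hβ hΓ hn₁ hn₂ hρ₁ hn.le hρ₂ ha hb hab (hC s hs U hU)
    (hF₁ s hs U hU) (hF₂ s hs U hU) hβh₁ hβh₂ hle₁ hle₂ (hπ₁ s hs U hU) (hπ₂ s hs U hU) (hM s hs U hU)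

/-! ## §2 Column × threshold forms with `s`-dependent anchors `Q₁(s)`, `Q₂(s)` -/

/-- **NO `(β, μ)` CARRIES BOTH PHASES, COLUMN × THRESHOLD FORM, `s`-DEPENDENT ANCHORS** (hypotheses exactly as
`psT_not_thermal_mix_on_cell_of_columns_hotAnchorSS`, with `0 < n₁`): on `[s₁, s₂] × [U₁, U₂]`, for every `β ≥ β₀` and every `μ`, no variational equilibrium of
`H(t,s,U) − μN` of density `≥ n₂` coexists with one of density `≤ n₁`. [cite: Israel1979, Thm. I.2.4] [cite: PoulinHastings2011, eqs. (3)–(8)] [cite: Ruelle1969, §3.4] -/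
theorem psGCT_not_equilibrium_on_cell_of_columns_hotAnchorSS (t : ℝ) {s₁ s₂ U₁ U₂ n₁ n₂ a b c₀ c₁ β β₀ βh₁ βh₂ : ℝ}
    (hU₁ : 0 ≤ U₁) (h12 : U₁ < U₂) (hn₁ : 0 < n₁) (hn : n₁ < n₂) (hn₂ : n₂ < 2) (ha : 0 ≤ a) (hb : 0 ≤ b)
    (hab : a + b = 1) (hβh₁ : 0 ≤ βh₁) (hβh₂ : 0 ≤ βh₂) (h0₁ : βh₁ ≤ β₀) (h0₂ : βh₂ ≤ β₀) (hβ₀ : β₀ ≤ β)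
    (hβ₀pos : 0 < β₀) {L₁ L₂ F₁ Q₁ Q₂ : ℝ → ℝ}
    (hC : ∀ s ∈ Icc s₁ s₂, ∀ U ∈ Icc U₁ U₂, energyDensityTT' t s U (a * n₁ + b * n₂) ≤ c₀ + c₁ * U)
    (hL₁ : ∀ s ∈ Icc s₁ s₂, L₁ s ≤ energyDensityTT' t s U₁ n₂) (hL₂ : ∀ s ∈ Icc s₁ s₂, L₂ s ≤ energyDensityTT' t s U₂ n₂)
    (hF₁ : ∀ s ∈ Icc s₁ s₂, ∀ U ∈ Icc U₁ U₂, F₁ s ≤ energyDensityTT' t s U n₁)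
    (hπ₁ : ∀ s ∈ Icc s₁ s₂, ∀ U ∈ Icc U₁ U₂, pressureTT' βh₁ t s U n₁ ≤ Q₁ s)
    (hπ₂ : ∀ s ∈ Icc s₁ s₂, ∀ U ∈ Icc U₁ U₂, pressureTT' βh₂ t s U n₂ ≤ Q₂ s)
    (hm₁ : ∀ s ∈ Icc s₁ s₂, 0 ≤ a * F₁ s + b * L₁ s - (c₀ + c₁ * U₁))
    (hm₂ : ∀ s ∈ Icc s₁ s₂, 0 ≤ a * F₁ s + b * L₂ s - (c₀ + c₁ * U₂))
    (hg₁ : ∀ s ∈ Icc s₁ s₂,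
      a * Q₁ s + b * Q₂ s + βh₁ * (a * F₁ s) + βh₂ * (b * L₁ s) < β₀ * (a * F₁ s + b * L₁ s - (c₀ + c₁ * U₁)))
    (hg₂ : ∀ s ∈ Icc s₁ s₂,
      a * Q₁ s + b * Q₂ s + βh₁ * (a * F₁ s) + βh₂ * (b * L₂ s) < β₀ * (a * F₁ s + b * L₂ s - (c₀ + c₁ * U₂)))
    {s : ℝ} (hs : s ∈ Icc s₁ s₂) {U : ℝ} (hU : U ∈ Icc U₁ U₂)
    {Γ : FermionInteraction 2} {R' μ : ℝ} {ω₁ ω₂ : InfVolFermionState 2} (hω₁ : ω₁.IsVarEquilibrium β Γ R')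
    (hΓ : ∀ σ : InfVolFermionState 2, σ.meanEnergy Γ R' = σ.meanEnergy (hubbardTTPrimeFermionInteraction t s U) 1 - μ * σ.density)
    (hρ₁ : ω₁.density ≤ n₁) (hρ₂ : n₂ ≤ ω₂.density) :
    ¬ ω₂.IsVarEquilibrium β Γ R' := by
  have hn2' : 0 ≤ n₂ := hn₁.le.trans hn.le
  have hβpos : 0 < β := hβ₀pos.trans_le hβ₀
  refine psGCT_not_equilibrium_on_cell_of_fns_hotAnchorFn t hU₁ hβpos hn₁ hn hn₂ ha hb hab hβh₁ hβh₂ (h0₁.trans hβ₀)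
    (h0₂.trans hβ₀) (C := fun _ U => c₀ + c₁ * U) (F₁ := fun s _ => F₁ s)
    (F₂ := fun s U => ((U₂ - U) * L₁ s + (U - U₁) * L₂ s) / (U₂ - U₁)) (P₁ := fun s _ => Q₁ s) (P₂ := fun s _ => Q₂ s) hC hF₁
    (floor_on_cell_of_columnLaws t hn2' hn₂ hU₁ h12 hL₁ hL₂) hπ₁ hπ₂ ?_ hs hU hω₁ hΓ hρ₁ hρ₂
  intro s hs U hU
  have hd : (U₂ - U₁) ≠ 0 := (sub_pos.2 h12).ne'
  have e₁ : a * Q₁ s + b * Q₂ s <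
      β₀ * (a * F₁ s + b * L₁ s - (c₀ + c₁ * U₁)) - (βh₁ * (a * F₁ s) + βh₂ * (b * L₁ s)) := by
    have := hg₁ s hs; linarith
  have e₂ : a * Q₁ s + b * Q₂ s <
      β₀ * (a * F₁ s + b * L₂ s - (c₀ + c₁ * U₂)) - (βh₁ * (a * F₁ s) + βh₂ * (b * L₂ s)) := by
    have := hg₂ s hs; linarith
  have hchord := chord_gt_of_ends_gt h12 hU e₁ e₂
  have hid : β₀ * (a * F₁ s + b * (((U₂ - U) * L₁ s + (U - U₁) * L₂ s) / (U₂ - U₁)) - (c₀ + c₁ * U)) -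
        (βh₁ * (a * F₁ s) + βh₂ * (b * (((U₂ - U) * L₁ s + (U - U₁) * L₂ s) / (U₂ - U₁)))) =
      ((U₂ - U) * (β₀ * (a * F₁ s + b * L₁ s - (c₀ + c₁ * U₁)) - (βh₁ * (a * F₁ s) + βh₂ * (b * L₁ s))) +
        (U - U₁) * (β₀ * (a * F₁ s + b * L₂ s - (c₀ + c₁ * U₂)) - (βh₁ * (a * F₁ s) + βh₂ * (b * L₂ s)))) /
        (U₂ - U₁) := by
    field_simp
    ring
  rw [← hid] at hchord
  have hge := chord_ge_of_ends_ge h12 hU (hm₁ s hs) (hm₂ s hs)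
  have hidM : a * F₁ s + b * (((U₂ - U) * L₁ s + (U - U₁) * L₂ s) / (U₂ - U₁)) - (c₀ + c₁ * U) =
      ((U₂ - U) * (a * F₁ s + b * L₁ s - (c₀ + c₁ * U₁)) + (U - U₁) * (a * F₁ s + b * L₂ s - (c₀ + c₁ * U₂))) /
        (U₂ - U₁) := by
    field_simp
    ring
  have hM : 0 ≤ a * F₁ s + b * (((U₂ - U) * L₁ s + (U - U₁) * L₂ s) / (U₂ - U₁)) - (c₀ + c₁ * U) := hidM ▸ hge
  have k := mul_le_mul_of_nonneg_right hβ₀ hM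
  show a * Q₁ s + b * Q₂ s + βh₁ * (a * F₁ s) + βh₂ * (b * (((U₂ - U) * L₁ s + (U - U₁) * L₂ s) / (U₂ - U₁))) <
    β * (a * F₁ s + b * (((U₂ - U) * L₁ s + (U - U₁) * L₂ s) / (U₂ - U₁)) - (c₀ + c₁ * U))
  linarith

/-- **NO `(β, μ)` CARRIES BOTH PHASES, ABOVE A COLUMN, `s`-DEPENDENT ANCHORS** (cap non-decreasing in `U`, one column law, far-end check; as
`psT_not_thermal_mix_above_column_hotAnchorSS`, with `0 < n₁`). [cite: Israel1979, Thm. I.2.4] [cite: Griffiths1966, §II] [cite: PoulinHastings2011, eqs. (3)–(8)] -/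
theorem psGCT_not_equilibrium_above_column_hotAnchorSS (t : ℝ) {s₁ s₂ U₂ U₃ n₁ n₂ a b c₀ c₁ β β₀ βh₁ βh₂ : ℝ}
    (hU₂ : 0 ≤ U₂) (hc₁ : 0 ≤ c₁) (hn₁ : 0 < n₁) (hn : n₁ < n₂) (hn₂ : n₂ < 2) (ha : 0 ≤ a) (hb : 0 ≤ b)
    (hab : a + b = 1) (hβh₁ : 0 ≤ βh₁) (hβh₂ : 0 ≤ βh₂) (h0₁ : βh₁ ≤ β₀) (h0₂ : βh₂ ≤ β₀) (hβ₀ : β₀ ≤ β) (hβ₀pos : 0 < β₀)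
    {L F₁ Q₁ Q₂ : ℝ → ℝ}
    (hC : ∀ s ∈ Icc s₁ s₂, ∀ U ∈ Icc U₂ U₃, energyDensityTT' t s U (a * n₁ + b * n₂) ≤ c₀ + c₁ * U)
    (hL : ∀ s ∈ Icc s₁ s₂, L s ≤ energyDensityTT' t s U₂ n₂)
    (hF₁ : ∀ s ∈ Icc s₁ s₂, ∀ U ∈ Icc U₂ U₃, F₁ s ≤ energyDensityTT' t s U n₁)
    (hπ₁ : ∀ s ∈ Icc s₁ s₂, ∀ U ∈ Icc U₂ U₃, pressureTT' βh₁ t s U n₁ ≤ Q₁ s)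
    (hπ₂ : ∀ s ∈ Icc s₁ s₂, ∀ U ∈ Icc U₂ U₃, pressureTT' βh₂ t s U n₂ ≤ Q₂ s)
    (hm : ∀ s ∈ Icc s₁ s₂, 0 ≤ a * F₁ s + b * L s - (c₀ + c₁ * U₃))
    (hg : ∀ s ∈ Icc s₁ s₂,
      a * Q₁ s + b * Q₂ s + βh₁ * (a * F₁ s) + βh₂ * (b * L s) < β₀ * (a * F₁ s + b * L s - (c₀ + c₁ * U₃)))
    {s : ℝ} (hs : s ∈ Icc s₁ s₂) {U : ℝ} (hU : U ∈ Icc U₂ U₃)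
    {Γ : FermionInteraction 2} {R' μ : ℝ} {ω₁ ω₂ : InfVolFermionState 2} (hω₁ : ω₁.IsVarEquilibrium β Γ R')
    (hΓ : ∀ σ : InfVolFermionState 2, σ.meanEnergy Γ R' = σ.meanEnergy (hubbardTTPrimeFermionInteraction t s U) 1 - μ * σ.density)
    (hρ₁ : ω₁.density ≤ n₁) (hρ₂ : n₂ ≤ ω₂.density) :
    ¬ ω₂.IsVarEquilibrium β Γ R' := by
  have hn2' : 0 ≤ n₂ := hn₁.le.trans hn.le
  refine psGCT_not_equilibrium_on_cell_of_fns_hotAnchorFn t hU₂ (hβ₀pos.trans_le hβ₀) hn₁ hn hn₂ ha hb hab hβh₁ hβh₂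
    (h0₁.trans hβ₀) (h0₂.trans hβ₀) (C := fun _ U => c₀ + c₁ * U) (F₁ := fun s _ => F₁ s) (F₂ := fun s _ => L s)
    (P₁ := fun s _ => Q₁ s) (P₂ := fun s _ => Q₂ s) hC hF₁
    (fun s hs U hU => floor_above_column_of_law t hn2' hn₂ hU₂ hL s hs U hU.1) hπ₁ hπ₂ ?_ hs hU hω₁ hΓ hρ₁ hρ₂
  intro s hs U hU
  have k := mul_le_mul_of_nonneg_left hU.2 hc₁
  have hM3 := hm s hs
  have hM : a * F₁ s + b * L s - (c₀ + c₁ * U₃) ≤ a * F₁ s + b * L s - (c₀ + c₁ * U) := by linarith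
  have hMU : 0 ≤ a * F₁ s + b * L s - (c₀ + c₁ * U) := hM3.trans hM
  have k1 := mul_le_mul_of_nonneg_left hM hβ₀pos.le
  have k2 := mul_le_mul_of_nonneg_right hβ₀ hMU
  have hg' := hg s hs
  show a * Q₁ s + b * Q₂ s + βh₁ * (a * F₁ s) + βh₂ * (b * L s) < β * (a * F₁ s + b * L s - (c₀ + c₁ * U))
  linarith

/-- **CELL-UNIFORM `T > 0` GAP, COLUMN × THRESHOLD FORM, `s`-DEPENDENT ANCHORS `Q₁(s)`, `Q₂(s)`**: cap affine in `U`, two `n₂`-column laws, dilute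
floor, both column margins `≥ g` and `a Q₁(s) + b Q₂(s) + β_{h,1} a F₁(s) + β_{h,2} b L_i(s) ≤ β₀·(a F₁(s) + b L_i(s) − (c₀ + c₁U_i) − g)` on both columns; then
on `[s₁, s₂] × [U₁, U₂]`, for every `β ≥ β₀`: `a·b·(n₂ − n₁)·(μ₂ − μ₁) ≥ g`. [cite: Israel1979, Thm. I.2.4] [cite: Ruelle1969, §3.4] [cite: PoulinHastings2011, eqs. (3)–(8)] -/
theorem psGCT_gap_on_cell_of_columns_hotAnchorSS (t : ℝ) {s₁ s₂ U₁ U₂ n₁ n₂ a b c₀ c₁ β₀ βh₁ βh₂ g : ℝ}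
    (hU₁ : 0 ≤ U₁) (h12 : U₁ < U₂) (hn₁ : 0 < n₁) (hn : n₁ < n₂) (hn₂ : n₂ < 2) (ha : 0 ≤ a) (hb : 0 ≤ b)
    (hab : a + b = 1) (hβh₁ : 0 ≤ βh₁) (hβh₂ : 0 ≤ βh₂) (h0₁ : βh₁ ≤ β₀) (h0₂ : βh₂ ≤ β₀) (hβ₀pos : 0 < β₀) {L₁ L₂ F₁ Q₁ Q₂ : ℝ → ℝ}
    (hC : ∀ s ∈ Icc s₁ s₂, ∀ U ∈ Icc U₁ U₂, energyDensityTT' t s U (a * n₁ + b * n₂) ≤ c₀ + c₁ * U)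
    (hL₁ : ∀ s ∈ Icc s₁ s₂, L₁ s ≤ energyDensityTT' t s U₁ n₂) (hL₂ : ∀ s ∈ Icc s₁ s₂, L₂ s ≤ energyDensityTT' t s U₂ n₂)
    (hF₁ : ∀ s ∈ Icc s₁ s₂, ∀ U ∈ Icc U₁ U₂, F₁ s ≤ energyDensityTT' t s U n₁)
    (hπ₁ : ∀ s ∈ Icc s₁ s₂, ∀ U ∈ Icc U₁ U₂, pressureTT' βh₁ t s U n₁ ≤ Q₁ s)
    (hπ₂ : ∀ s ∈ Icc s₁ s₂, ∀ U ∈ Icc U₁ U₂, pressureTT' βh₂ t s U n₂ ≤ Q₂ s)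
    (hgm₁ : ∀ s ∈ Icc s₁ s₂, g ≤ a * F₁ s + b * L₁ s - (c₀ + c₁ * U₁))
    (hgm₂ : ∀ s ∈ Icc s₁ s₂, g ≤ a * F₁ s + b * L₂ s - (c₀ + c₁ * U₂))
    (hN₁ : ∀ s ∈ Icc s₁ s₂,
      a * Q₁ s + b * Q₂ s + βh₁ * (a * F₁ s) + βh₂ * (b * L₁ s) ≤ β₀ * (a * F₁ s + b * L₁ s - (c₀ + c₁ * U₁) - g))
    (hN₂ : ∀ s ∈ Icc s₁ s₂,
      a * Q₁ s + b * Q₂ s + βh₁ * (a * F₁ s) + βh₂ * (b * L₂ s) ≤ β₀ * (a * F₁ s + b * L₂ s - (c₀ + c₁ * U₂) - g))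
    {s : ℝ} (hs : s ∈ Icc s₁ s₂) {U : ℝ} (hU : U ∈ Icc U₁ U₂) {β : ℝ} (hβ : β₀ ≤ β)
    {Γ₁ Γ₂ : FermionInteraction 2} {R₁ R₂ μ₁ μ₂ : ℝ} {ω₁ ω₂ : InfVolFermionState 2}
    (hω₁ : ω₁.IsVarEquilibrium β Γ₁ R₁)
    (hΓ₁ : ∀ σ : InfVolFermionState 2, σ.meanEnergy Γ₁ R₁ = σ.meanEnergy (hubbardTTPrimeFermionInteraction t s U) 1 - μ₁ * σ.density)
    (hω₂ : ω₂.IsVarEquilibrium β Γ₂ R₂)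
    (hΓ₂ : ∀ σ : InfVolFermionState 2, σ.meanEnergy Γ₂ R₂ = σ.meanEnergy (hubbardTTPrimeFermionInteraction t s U) 1 - μ₂ * σ.density)
    (hρ₁ : ω₁.density ≤ n₁) (hρ₂ : n₂ ≤ ω₂.density) :
    g ≤ a * b * (n₂ - n₁) * (μ₂ - μ₁) := by
  have hn2' : 0 ≤ n₂ := hn₁.le.trans hn.le
  refine psGCT_gap_on_cell_of_fns_hotAnchorFn t hU₁ hβ₀pos hn₁ hn hn₂ ha hb hab hβh₁ hβh₂ h0₁ h0₂
    (C := fun _ U => c₀ + c₁ * U) (F₁ := fun s _ => F₁ s)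
    (F₂ := fun s U => ((U₂ - U) * L₁ s + (U - U₁) * L₂ s) / (U₂ - U₁)) (P₁ := fun s _ => Q₁ s) (P₂ := fun s _ => Q₂ s) hC hF₁
    (floor_on_cell_of_columnLaws t hn2' hn₂ hU₁ h12 hL₁ hL₂) hπ₁ hπ₂ ?_ ?_ hs hU hβ hω₁ hΓ₁ hω₂ hΓ₂ hρ₁ hρ₂
  · intro s hs U hU
    have hd : (U₂ - U₁) ≠ 0 := (sub_pos.2 h12).ne'
    have hge := chord_ge_of_ends_ge h12 hU (hgm₁ s hs) (hgm₂ s hs)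
    have hidM : a * F₁ s + b * (((U₂ - U) * L₁ s + (U - U₁) * L₂ s) / (U₂ - U₁)) - (c₀ + c₁ * U) =
        ((U₂ - U) * (a * F₁ s + b * L₁ s - (c₀ + c₁ * U₁)) + (U - U₁) * (a * F₁ s + b * L₂ s - (c₀ + c₁ * U₂))) /
          (U₂ - U₁) := by
      field_simp
      ring
    show g ≤ a * F₁ s + b * (((U₂ - U) * L₁ s + (U - U₁) * L₂ s) / (U₂ - U₁)) - (c₀ + c₁ * U)
    rw [hidM]
    exact hge
  · intro s hs U hU
    have hd : (U₂ - U₁) ≠ 0 := (sub_pos.2 h12).ne'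
    have e₁ : 0 ≤ β₀ * (a * F₁ s + b * L₁ s - (c₀ + c₁ * U₁) - g) - (a * Q₁ s + b * Q₂ s + βh₁ * (a * F₁ s) + βh₂ * (b * L₁ s)) := by
      have := hN₁ s hs; linarith
    have e₂ : 0 ≤ β₀ * (a * F₁ s + b * L₂ s - (c₀ + c₁ * U₂) - g) - (a * Q₁ s + b * Q₂ s + βh₁ * (a * F₁ s) + βh₂ * (b * L₂ s)) := by
      have := hN₂ s hs; linarith
    have hchord := chord_ge_of_ends_ge h12 hU e₁ e₂
    have hid : β₀ * (a * F₁ s + b * (((U₂ - U) * L₁ s + (U - U₁) * L₂ s) / (U₂ - U₁)) - (c₀ + c₁ * U) - g) -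
          (a * Q₁ s + b * Q₂ s + βh₁ * (a * F₁ s) + βh₂ * (b * (((U₂ - U) * L₁ s + (U - U₁) * L₂ s) / (U₂ - U₁)))) =
        ((U₂ - U) * (β₀ * (a * F₁ s + b * L₁ s - (c₀ + c₁ * U₁) - g) - (a * Q₁ s + b * Q₂ s + βh₁ * (a * F₁ s) + βh₂ * (b * L₁ s))) +
          (U - U₁) * (β₀ * (a * F₁ s + b * L₂ s - (c₀ + c₁ * U₂) - g) - (a * Q₁ s + b * Q₂ s + βh₁ * (a * F₁ s) + βh₂ * (b * L₂ s)))) /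
          (U₂ - U₁) := by
      field_simp
      ring
    rw [← hid] at hchord
    show a * Q₁ s + b * Q₂ s + βh₁ * (a * F₁ s) + βh₂ * (b * (((U₂ - U) * L₁ s + (U - U₁) * L₂ s) / (U₂ - U₁))) ≤
      β₀ * (a * F₁ s + b * (((U₂ - U) * L₁ s + (U - U₁) * L₂ s) / (U₂ - U₁)) - (c₀ + c₁ * U) - g)
    linarith

/-- **CELL-UNIFORM `T > 0` GAP ABOVE A COLUMN, `s`-DEPENDENT ANCHORS `Q₁(s)`, `Q₂(s)`** (cap with `c₁ ≥ 0`, one column law, far-end checks at `U₃`): on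
`[s₁, s₂] × [U₂, U₃]`, for every `β ≥ β₀`: `a·b·(n₂ − n₁)·(μ₂ − μ₁) ≥ g`. [cite: Israel1979, Thm. I.2.4] [cite: Griffiths1966, §II] [cite: PoulinHastings2011, eqs. (3)–(8)] -/
theorem psGCT_gap_above_column_hotAnchorSS (t : ℝ) {s₁ s₂ U₂ U₃ n₁ n₂ a b c₀ c₁ β₀ βh₁ βh₂ g : ℝ}
    (hU₂ : 0 ≤ U₂) (hc₁ : 0 ≤ c₁) (hn₁ : 0 < n₁) (hn : n₁ < n₂) (hn₂ : n₂ < 2) (ha : 0 ≤ a) (hb : 0 ≤ b)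
    (hab : a + b = 1) (hβh₁ : 0 ≤ βh₁) (hβh₂ : 0 ≤ βh₂) (h0₁ : βh₁ ≤ β₀) (h0₂ : βh₂ ≤ β₀) (hβ₀pos : 0 < β₀)
    {L F₁ Q₁ Q₂ : ℝ → ℝ}
    (hC : ∀ s ∈ Icc s₁ s₂, ∀ U ∈ Icc U₂ U₃, energyDensityTT' t s U (a * n₁ + b * n₂) ≤ c₀ + c₁ * U)
    (hL : ∀ s ∈ Icc s₁ s₂, L s ≤ energyDensityTT' t s U₂ n₂)
    (hF₁ : ∀ s ∈ Icc s₁ s₂, ∀ U ∈ Icc U₂ U₃, F₁ s ≤ energyDensityTT' t s U n₁)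
    (hπ₁ : ∀ s ∈ Icc s₁ s₂, ∀ U ∈ Icc U₂ U₃, pressureTT' βh₁ t s U n₁ ≤ Q₁ s)
    (hπ₂ : ∀ s ∈ Icc s₁ s₂, ∀ U ∈ Icc U₂ U₃, pressureTT' βh₂ t s U n₂ ≤ Q₂ s)
    (hgm : ∀ s ∈ Icc s₁ s₂, g ≤ a * F₁ s + b * L s - (c₀ + c₁ * U₃))
    (hN : ∀ s ∈ Icc s₁ s₂,
      a * Q₁ s + b * Q₂ s + βh₁ * (a * F₁ s) + βh₂ * (b * L s) ≤ β₀ * (a * F₁ s + b * L s - (c₀ + c₁ * U₃) - g))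
    {s : ℝ} (hs : s ∈ Icc s₁ s₂) {U : ℝ} (hU : U ∈ Icc U₂ U₃) {β : ℝ} (hβ : β₀ ≤ β)
    {Γ₁ Γ₂ : FermionInteraction 2} {R₁ R₂ μ₁ μ₂ : ℝ} {ω₁ ω₂ : InfVolFermionState 2}
    (hω₁ : ω₁.IsVarEquilibrium β Γ₁ R₁)
    (hΓ₁ : ∀ σ : InfVolFermionState 2, σ.meanEnergy Γ₁ R₁ = σ.meanEnergy (hubbardTTPrimeFermionInteraction t s U) 1 - μ₁ * σ.density)
    (hω₂ : ω₂.IsVarEquilibrium β Γ₂ R₂)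
    (hΓ₂ : ∀ σ : InfVolFermionState 2, σ.meanEnergy Γ₂ R₂ = σ.meanEnergy (hubbardTTPrimeFermionInteraction t s U) 1 - μ₂ * σ.density)
    (hρ₁ : ω₁.density ≤ n₁) (hρ₂ : n₂ ≤ ω₂.density) :
    g ≤ a * b * (n₂ - n₁) * (μ₂ - μ₁) := by
  have hn2' : 0 ≤ n₂ := hn₁.le.trans hn.le
  refine psGCT_gap_on_cell_of_fns_hotAnchorFn t hU₂ hβ₀pos hn₁ hn hn₂ ha hb hab hβh₁ hβh₂ h0₁ h0₂
    (C := fun _ U => c₀ + c₁ * U) (F₁ := fun s _ => F₁ s) (F₂ := fun s _ => L s) (P₁ := fun s _ => Q₁ s) (P₂ := fun s _ => Q₂ s) hC hF₁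
    (fun s hs U hU => floor_above_column_of_law t hn2' hn₂ hU₂ hL s hs U hU.1) hπ₁ hπ₂ ?_ ?_ hs hU hβ hω₁ hΓ₁ hω₂ hΓ₂ hρ₁ hρ₂
  · intro s hs U hU
    have k := mul_le_mul_of_nonneg_left hU.2 hc₁
    have h := hgm s hs
    show g ≤ a * F₁ s + b * L s - (c₀ + c₁ * U)
    linarith
  · intro s hs U hU
    have k := mul_le_mul_of_nonneg_left hU.2 hc₁
    have hg3 := hgm s hs
    have hM : a * F₁ s + b * L s - (c₀ + c₁ * U₃) - g ≤ a * F₁ s + b * L s - (c₀ + c₁ * U) - g := by linarith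
    have k1 := mul_le_mul_of_nonneg_left hM hβ₀pos.le
    have hN' := hN s hs
    show a * Q₁ s + b * Q₂ s + βh₁ * (a * F₁ s) + βh₂ * (b * L s) ≤ β₀ * (a * F₁ s + b * L s - (c₀ + c₁ * U) - g)
    linarith

end Summit.Ventures.CertifiedManyBodySolver.Observables
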